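import Literature.Geometry.Kaehler.ComplexTorusSelfIntersectionIndex
import HarnessLib

/-!
# Venture HSemireg — (S3)'s positivity input (H1) `∫_X bⁿ > 0` AT THE OBJECT LEVEL: on a complex torus
# `X = E/Φ(ℤ^ι)` of dimension `g`, for a non-degenerate class `η ∈ NS(X)`,
# **`∫_X η^{∧g} > 0 ⟺ g + index(H_η)` is even** — TRACK S4-PUSH (ii), seat `s4-prove-1` (g7);
# file of record `s4push/prove-1/ATTEMPT-8.md` §7

HONEST FRAMING. Lean index of the computation cell `pub-hsemireg`. OBJECT LEVEL, but only this object: the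
complex torus `X = E/Φ(ℤ^ι)` of the tree's Literature layer `Literature/Geometry/Kaehler/ComplexTorus*` (lane
`lit-hodgefound`), its invariant forms, the trace `∫_X := ComplexTorus.torusIntegral Φ e` on invariant top forms
(the COMPLEX orientation, `∫_X vol = 1`), the Néron–Severi predicate `ComplexTorus.IsNSForm Φ η` (a real `2`-form
with `η(iu, iv) = η(u, v)`, integral on the lattice), the intrinsic index `ComplexTorus.hermIndex η` of the Hermitian
form `H_η(v, w) = η(iv, w) + iη(v, w)` (Lange's, Lemma 1.2.10; Sylvester), types `ComplexTorus.IsPolarizationType`,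
and the wedge power `ComplexTorus.wedgePow`.  No sheaf, no secant plane, no Mukai pairing, no semiregularity map is
constructed; nothing here says that HC, HC_CM or HC_AV holds; nothing here is a new case of anything.  NO definition
and NO named fact is introduced: theorems only, all PROVED (0 sorry), all short consequences of the tree theorem
`ComplexTorus.IsNSForm.torusIntegral_wedgePow_of_isPolarizationType` (`∫_X η^{∧g} = (-1)^{g+s}·g!·d₁⋯d_g` for
`η ∈ NS(X)` non-degenerate of index `s` and type `d` — Lange 2023, Lemma 1.7.5 with the proof of Thm. 1.7.3,
formalised in `Literature/Geometry/Kaehler/ComplexTorusSelfIntersectionIndex.lean`, row A4-28 of that layer), which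
is USED, not restated.

WHAT (H1) IS (cell record).  STRUCTURE.md v1.0-SIGNED §2 (S3) «MOD-4 PARITY LAW» is PROVED (th-7, FORMULA-N-th7.md §D)
under the named hypothesis (H1) «`∫_X bⁿ > 0`», `b ∈ NS(X)_ℚ` the imaginary direction of the secant exponent
`B = a + √-d·b` on the abelian `n`-fold `X` (lane sheet `s4push/prove-1/STATEMENTS-S3INPUT.md` §0), `n` EVEN (at odd `n`
the pairing `(v,v)_χ` vanishes and (S3) says nothing).  The lane's record for (H1) so far: S3INP-1 «(H1) ⟺ `s(b)` even»
PROVED IN PRINT (Lange 2023 Thm. 1.7.1 + 1.7.3) + kernel AT MODEL LEVEL (`SecantParityPositivity.lean` dz-frame,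
`Mod4SignLaw.lean` diagonal frame, `SecantParityRealFrame.lean` real frame) + a paper dictionary.

WHAT THIS FILE PROVES (namespace `Summit.Ventures.HSemireg.SecantParity`; `Φ : (ι → ℝ) ≃L[ℝ] E` the lattice frame of
`X`, `η : E [⋀^Fin 2]→L[ℝ] ℝ`, `hη : IsNSForm Φ η`, `hnd :` non-degenerate, `hd : IsPolarizationType Φ η d`,
`e : Fin (2g) ≃ ι`, so `g = dim_ℂ X`; `open scoped ComplexOrder` — `0 < z` for `z : ℂ` means `z` is a positive real):
* `torusIntegral_wedgePow_eq_sign_mul_nat` — `∫_X η^{∧g} = (-1)^{g+s}·N` with `N = g!·d₁⋯d_g > 0` a natural number;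
* **`torusIntegral_wedgePow_pos_iff_even` — `∫_X η^{∧g} > 0 ⟺ g + s` even, EVERY `g`** (`s = hermIndex η`);
* **`torusIntegral_wedgePow_pos_iff_even_hermIndex` — at EVEN `g`: `∫_X η^{∧g} > 0 ⟺ s` even** — statement S3INP-1 of
  the sheet, in (S3)'s range, as a theorem about `∫_X`; `torusIntegral_wedgePow_neg_of_odd` — `g + s` odd ⇒
  `∫_X η^{∧g} < 0` ((H1) FAILS: the `E⁴` index-`1` situation of S3INP-4); `exists_torusIntegral_wedgePow_pos_iff_even`
  — the canonical form with THE rank `2g = rk Λ` and some type;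
* the POLARISED RANGE (S3INP-2): `IsRiemannForm.torusIntegral_wedgePow_pos_of_even` — `η` a Riemann form (`H_η`
  positive definite, index `0`; tree `IsRiemannForm.hermIndex_eq_zero`) and `g` even ⇒ `∫_X η^{∧g} > 0`;
  `IsRiemannForm.torusIntegral_wedgePow_neg_pos'` — `∫_X (-η)^{∧g} > 0` at EVERY `g` (`-η` = the invariant
  representative of `c₁(L(H, χ))`, Lange Lemma 1.7.4 «`c₁(L) = -Σ d_ν dx_ν∧dy_ν`», tree `isChernForm_ahMetric`; the tree's
  `torusIntegral_wedgePow_neg_pos` gives the value as a positive natural number);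
* RESCALING (the `ℚ` in `NS(X)_ℚ`): `torusIntegral_wedgePow_smul` — `∫_X (c·η)^{∧g} = cᵍ·∫_X η^{∧g}` (`c` real) and
  `torusIntegral_wedgePow_smul_pos_iff` — for `c ≠ 0` and `g` even, (H1) for `c·η` ⟺ (H1) for `η`: (H1) for a rational
  class reduces to its primitive integral multiple;
* `neg_one_pow_mul_natCast_pos_iff` — the sign bookkeeping `0 < (-1)ᵐ·N ⟺ m` even in `ℂ`.

WHAT STAYS OUTSIDE THIS FILE.  (i) That the `∫_X` of HRR / of `(v,v)_χ = ∫ v^∨·v` in FORMULA-N §D, applied to the de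
Rham class `bⁿ`, is `torusIntegral` of the invariant representative `b^{∧n}`: de Rham's theorem for `X` and
`H^{2g}(X, ℤ) ⥲ ℤ` by the complex orientation — the content of the tree's `torusIntegral` («`d : H^{2g}(X, ℤ) ⥲ ℤ`»,
Lange 2023 §6.2.4) and of `ComplexTorusDeRham.lean`; not re-derived here.  (ii) `X` an abelian variety: not needed
((H1) is a statement about a complex torus with a non-degenerate `NS` class).  (iii) Conventions: the sheet's
`s(b)` = «number of negative eigenvalues of the Hermitian form whose imaginary part is `b`»; with Lange's `H_b` (linear in
the FIRST argument, the tree's `hermOf`) the sign of `∫_X bⁿ` is `(-1)^{n + s(b)}`, which at EVEN `n` — all of (S3) — is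
`(-1)^{s(b)}` as the sheet says; at ODD `n` the all-`n` clause of S3INP-1 holds for the OTHER Hermitian convention
(`H(v,w) = b(v, iw) + i b(v,w)`, linear in the second argument, index `n - s(b)`), cf. `SecantParityRealFrame.lean` — a
wording precision for the sheet, immaterial to (S3).

All statements and proofs: s4-prove-1 g7 (2026-08-23); reads invited: s4-ref (statement-vs-STRUCTURE fidelity: the
binder is THE `b` as an `NS` class of the torus carrying the secant object, `∫_X` the oriented trace), s4-prove-3 (×2).

## References

* [Lange2023AbelianVarietiesComplex] H. Lange, Abelian Varieties over the Complex Numbers (2023), §1.2 Lemma 1.2.10,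
  §1.6.2 (index), §1.7.1 Thm. 1.7.1, §1.7.2 Thm. 1.7.3, Lemma 1.7.4, Lemma 1.7.5 and its proof, §2.1.3 Prop. 2.1.11,
  §6.2.4 (the trace `H^{2g}(X,ℤ) ⥲ ℤ`) — held text `book:lange1992-complex-abelian-varieties`, as cited in the imported
  Literature file.
-/

noncomputable section

open scoped ComplexOrder
open Literature.Geometry.Kaehler Literature.Geometry.Kaehler.ComplexTorus

namespace Summit.Ventures.HSemireg

namespace SecantParity

/-- Sign bookkeeping in `ℂ` with its partial order: for a positive natural number `N`,
`0 < (-1)ᵐ · N ⟺ m` even. [folklore] -/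
theorem neg_one_pow_mul_natCast_pos_iff {m N : ℕ} (hN : 0 < N) :
    (0 : ℂ) < (-1 : ℂ) ^ m * (N : ℂ) ↔ Even m := by
  rcases Nat.even_or_odd m with hm | hm
  · rw [hm.neg_one_pow, one_mul]
    exact ⟨fun _ ↦ hm, fun _ ↦ by exact_mod_cast hN⟩
  · rw [hm.neg_one_pow, neg_one_mul]
    refine ⟨fun h ↦ ?_, fun h ↦ absurd h (Nat.not_even_iff_odd.mpr hm)⟩
    have h' : (0 : ℂ) < (N : ℂ) := by exact_mod_cast hN
    have : (0 : ℂ) < -(N : ℂ) + (N : ℂ) := add_pos h h'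
    rw [neg_add_cancel] at this
    exact absurd this (lt_irrefl 0)

variable {ι : Type*} [Fintype ι] [DecidableEq ι] {E : Type*} [NormedAddCommGroup E] [NormedSpace ℂ E]
  (Φ : (ι → ℝ) ≃L[ℝ] E) {η : E [⋀^Fin 2]→L[ℝ] ℝ}

/-- The value of `∫_X η^{∧g}` as `(-1)^{g+s}` times a POSITIVE natural number (`g!·d₁⋯d_g`).
[cite: Lange2023AbelianVarietiesComplex, §1.7.2 Lemma 1.7.5 and proof of Thm. 1.7.3] -/
theorem torusIntegral_wedgePow_eq_sign_mul_nat (hη : IsNSForm Φ η)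
    (hnd : ∀ v : E, v ≠ 0 → ∃ w : E, η ![v, w] ≠ 0) {g : ℕ} {d : Fin g → ℕ}
    (hd : IsPolarizationType Φ η d) (e : Fin (2 * g) ≃ ι) :
    ∃ N : ℕ, 0 < N ∧
      torusIntegral Φ e (wedgePow (ofRealForm η) g) = (-1 : ℂ) ^ (g + hermIndex η) * (N : ℂ) := by
  refine ⟨g.factorial * ∏ i, d i,
    Nat.mul_pos (Nat.factorial_pos g) (Finset.prod_pos fun i _ ↦ hη.pos_of_isPolarizationType Φ hnd hd i), ?_⟩
  rw [hη.torusIntegral_wedgePow_of_isPolarizationType Φ hnd hd e]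
  push_cast
  ring

/-- **(H1) ⟺ PARITY, at the object level, every dimension.** For `η ∈ NS(X)` non-degenerate on the
complex torus `X = E/Φ(ℤ^ι)` of dimension `g`, with `s = hermIndex η` the index of its Hermitian form
`H(v,w) = η(iv,w) + iη(v,w)`: **`∫_X η^{∧g} > 0 ⟺ g + s` is even** (`∫_X` = `torusIntegral`, the complex
orientation). [cite: Lange2023AbelianVarietiesComplex, §1.7.2 Lemma 1.7.5 and proof of Thm. 1.7.3] -/
theorem torusIntegral_wedgePow_pos_iff_even (hη : IsNSForm Φ η)
    (hnd : ∀ v : E, v ≠ 0 → ∃ w : E, η ![v, w] ≠ 0) {g : ℕ} {d : Fin g → ℕ}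
    (hd : IsPolarizationType Φ η d) (e : Fin (2 * g) ≃ ι) :
    0 < torusIntegral Φ e (wedgePow (ofRealForm η) g) ↔ Even (g + hermIndex η) := by
  obtain ⟨N, hN, hval⟩ := torusIntegral_wedgePow_eq_sign_mul_nat Φ hη hnd hd e
  rw [hval]
  exact neg_one_pow_mul_natCast_pos_iff hN

/-- **(H1) ⟺ INDEX EVEN, in (S3)'s range (even dimension).** For `η ∈ NS(X)` non-degenerate on a complex
torus of EVEN dimension `g = n`: `∫_X η^{∧n} > 0 ⟺ index(H_η)` even — statement S3INP-1 of the lane's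
sheet, now a theorem about `∫_X`. [cite: Lange2023AbelianVarietiesComplex, §1.7.1 Thm. 1.7.1 and §1.7.2 Thm. 1.7.3] -/
theorem torusIntegral_wedgePow_pos_iff_even_hermIndex (hη : IsNSForm Φ η)
    (hnd : ∀ v : E, v ≠ 0 → ∃ w : E, η ![v, w] ≠ 0) {g : ℕ} {d : Fin g → ℕ}
    (hd : IsPolarizationType Φ η d) (e : Fin (2 * g) ≃ ι) (hg : Even g) :
    0 < torusIntegral Φ e (wedgePow (ofRealForm η) g) ↔ Even (hermIndex η) := by
  rw [torusIntegral_wedgePow_pos_iff_even Φ hη hnd hd e, Nat.even_add]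
  exact ⟨fun h ↦ h.mp hg, fun h ↦ ⟨fun _ ↦ h, fun _ ↦ hg⟩⟩

/-- **ODD PARITY ⇒ (H1) FAILS**: if `g + index(H_η)` is odd then `∫_X η^{∧g} < 0` (e.g. an index-`1`
class on an abelian fourfold — the `E⁴` counter-model of the lane's sheet, S3INP-4).
[cite: Lange2023AbelianVarietiesComplex, §1.7.2 Lemma 1.7.5 and proof of Thm. 1.7.3] -/
theorem torusIntegral_wedgePow_neg_of_odd (hη : IsNSForm Φ η)
    (hnd : ∀ v : E, v ≠ 0 → ∃ w : E, η ![v, w] ≠ 0) {g : ℕ} {d : Fin g → ℕ}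
    (hd : IsPolarizationType Φ η d) (e : Fin (2 * g) ≃ ι) (hodd : Odd (g + hermIndex η)) :
    torusIntegral Φ e (wedgePow (ofRealForm η) g) < 0 := by
  obtain ⟨N, hN, hval⟩ := torusIntegral_wedgePow_eq_sign_mul_nat Φ hη hnd hd e
  rw [hval, hodd.neg_one_pow, neg_one_mul, neg_lt_zero]
  exact_mod_cast hN

/-- **Canonical form (no type chosen).** Every non-degenerate `η ∈ NS(X)` has a type `(d₁,…,d_g)` with
`2g = rk Λ`, and for it `∫_X η^{∧g} > 0 ⟺ g + index(H_η)` even.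
[cite: Lange2023AbelianVarietiesComplex, §1.7.2 Lemma 1.7.5 and proof of Thm. 1.7.3] -/
theorem exists_torusIntegral_wedgePow_pos_iff_even (hη : IsNSForm Φ η)
    (hnd : ∀ v : E, v ≠ 0 → ∃ w : E, η ![v, w] ≠ 0) :
    ∃ (g : ℕ) (d : Fin g → ℕ) (e : Fin (2 * g) ≃ ι), IsPolarizationType Φ η d ∧
      (0 < torusIntegral Φ e (wedgePow (ofRealForm η) g) ↔ Even (g + hermIndex η)) := by
  obtain ⟨g, d, e, hd, -, -, -⟩ := hη.exists_torusIntegral_wedgePow_eq Φ hnd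
  exact ⟨g, d, e, hd, torusIntegral_wedgePow_pos_iff_even Φ hη hnd hd e⟩

/-- **(H1) HOLDS IN THE POLARISED RANGE, I**: for a Riemann form `η` (`H_η` positive definite, index `0`)
on a torus of EVEN dimension, `∫_X η^{∧g} > 0`. [cite: Lange2023AbelianVarietiesComplex, §1.7.2 proof of Thm. 1.7.3] -/
theorem IsRiemannForm.torusIntegral_wedgePow_pos_of_even (hη : IsRiemannForm Φ η) {g : ℕ} {d : Fin g → ℕ}
    (hd : IsPolarizationType Φ η d) (e : Fin (2 * g) ≃ ι) (hg : Even g) :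
    0 < torusIntegral Φ e (wedgePow (ofRealForm η) g) := by
  rw [torusIntegral_wedgePow_pos_iff_even_hermIndex Φ hη.isNSForm (hη.exists_apply_ne_zero Φ) hd e hg,
    hη.hermIndex_eq_zero Φ]
  exact Even.zero

/-- **(H1) HOLDS IN THE POLARISED RANGE, II**: for a Riemann form `η`, the class `-η` (index `g`; the de
Rham representative of `c₁(L(H,χ))`, Lange's Lemma 1.7.4) has `∫_X (-η)^{∧g} > 0` in EVERY dimension.
[cite: Lange2023AbelianVarietiesComplex, §2.1.3 Prop. 2.1.11] -/
theorem IsRiemannForm.torusIntegral_wedgePow_neg_pos' (hη : IsRiemannForm Φ η) {g : ℕ} {d : Fin g → ℕ}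
    (hd : IsPolarizationType Φ η d) (e : Fin (2 * g) ≃ ι) :
    0 < torusIntegral Φ e (wedgePow (ofRealForm (-η)) g) := by
  obtain ⟨n, hn, hval⟩ := hη.torusIntegral_wedgePow_neg_pos Φ hd e
  rw [hval]
  exact_mod_cast hn

omit [Fintype ι] in
/-- **Rescaling**: `∫_X (c·η)^{∧g} = cᵍ · ∫_X η^{∧g}` for real `c` — (H1) for a rational class
`b = c·η ∈ NS(X)_ℚ` reduces to the integral class `η` (at even `g` the sign is that of `η`).
[cite: Lange2023AbelianVarietiesComplex, §1.7.2] -/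
theorem torusIntegral_wedgePow_smul (c : ℝ) (g : ℕ) (e : Fin (2 * g) ≃ ι) :
    torusIntegral Φ e (wedgePow (ofRealForm (c • η)) g) =
      (c : ℂ) ^ g * torusIntegral Φ e (wedgePow (ofRealForm η) g) := by
  rw [ComplexTorus.ofRealForm_smul, wedgePow_smul, ComplexTorus.torusIntegral_smul]

omit [Fintype ι] in
/-- **(H1) for `b = c·η`, `c ≠ 0` real, `g` even ⟺ (H1) for `η`.** [cite: Lange2023AbelianVarietiesComplex, §1.7.2] -/
theorem torusIntegral_wedgePow_smul_pos_iff {c : ℝ} (hc : c ≠ 0) {g : ℕ} (hg : Even g) (e : Fin (2 * g) ≃ ι) :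
    0 < torusIntegral Φ e (wedgePow (ofRealForm (c • η)) g) ↔
      0 < torusIntegral Φ e (wedgePow (ofRealForm η) g) := by
  rw [torusIntegral_wedgePow_smul]
  have hcg : (0 : ℝ) < c ^ g := hg.pow_pos hc
  have hcg' : (0 : ℂ) < ((c ^ g : ℝ) : ℂ) := Complex.zero_lt_real.mpr hcg
  rw [← Complex.ofReal_pow]
  constructor
  · intro h
    have hinv : (0 : ℂ) < (((c ^ g)⁻¹ : ℝ) : ℂ) := Complex.zero_lt_real.mpr (inv_pos.mpr hcg)
    have h2 := mul_pos hinv h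
    rwa [← mul_assoc, ← Complex.ofReal_mul, inv_mul_cancel₀ hcg.ne', Complex.ofReal_one, one_mul] at h2
  · intro h
    exact mul_pos hcg' h

/-! ### Type-free forms of the criterion (s4-ref g11 P-1): the binder `hd : IsPolarizationType Φ η d` of the
criterion theorems is dispensable — every non-degenerate `η ∈ NS(X)` has a type (tree
`IsNSForm.exists_isPolarizationType_of_nondegenerate`) and its `g` is THE `g` with `2g = |ι|` (`IsPolarizationType.card_eq`). -/

/-- **(H1) ⟺ PARITY, type-free.** For `η ∈ NS(X)` non-degenerate on the complex torus `X = E/Φ(ℤ^ι)` of dimension `g`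
(`e : Fin (2g) ≃ ι`): `∫_X η^{∧g} > 0 ⟺ g + hermIndex η` even — no polarisation type among the binders.
[cite: Lange2023AbelianVarietiesComplex, §1.7.2 Lemma 1.7.5 and proof of Thm. 1.7.3] -/
theorem torusIntegral_wedgePow_pos_iff_even' (hη : IsNSForm Φ η)
    (hnd : ∀ v : E, v ≠ 0 → ∃ w : E, η ![v, w] ≠ 0) {g : ℕ} (e : Fin (2 * g) ≃ ι) :
    0 < torusIntegral Φ e (wedgePow (ofRealForm η) g) ↔ Even (g + hermIndex η) := by
  obtain ⟨g', d, hd, -⟩ := hη.exists_isPolarizationType_of_nondegenerate Φ hnd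
  have hcard : Fintype.card ι = 2 * g := by
    have h := Fintype.card_congr e
    rw [Fintype.card_fin] at h
    exact h.symm
  have hg : g' = g := by
    have h' := hd.card_eq
    omega
  subst hg
  exact torusIntegral_wedgePow_pos_iff_even Φ hη hnd hd e

/-- **(H1) ⟺ INDEX EVEN at even dimension, type-free** (S3INP-1 in (S3)'s range with only THE `b`, its
non-degeneracy and the dimension among the binders). [cite: Lange2023AbelianVarietiesComplex, §1.7.1 Thm. 1.7.1 and §1.7.2 Thm. 1.7.3] -/
theorem torusIntegral_wedgePow_pos_iff_even_hermIndex' (hη : IsNSForm Φ η)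
    (hnd : ∀ v : E, v ≠ 0 → ∃ w : E, η ![v, w] ≠ 0) {g : ℕ} (e : Fin (2 * g) ≃ ι) (hg : Even g) :
    0 < torusIntegral Φ e (wedgePow (ofRealForm η) g) ↔ Even (hermIndex η) := by
  rw [torusIntegral_wedgePow_pos_iff_even' Φ hη hnd e, Nat.even_add]
  exact ⟨fun h ↦ h.mp hg, fun h ↦ ⟨fun _ ↦ h, fun _ ↦ hg⟩⟩

/-- **ODD PARITY ⇒ (H1) FAILS, type-free**: `g + hermIndex η` odd ⇒ `∫_X η^{∧g} < 0`.
[cite: Lange2023AbelianVarietiesComplex, §1.7.2 Lemma 1.7.5 and proof of Thm. 1.7.3] -/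
theorem torusIntegral_wedgePow_neg_of_odd' (hη : IsNSForm Φ η)
    (hnd : ∀ v : E, v ≠ 0 → ∃ w : E, η ![v, w] ≠ 0) {g : ℕ} (e : Fin (2 * g) ≃ ι)
    (hodd : Odd (g + hermIndex η)) :
    torusIntegral Φ e (wedgePow (ofRealForm η) g) < 0 := by
  obtain ⟨g', d, hd, -⟩ := hη.exists_isPolarizationType_of_nondegenerate Φ hnd
  have hcard : Fintype.card ι = 2 * g := by
    have h := Fintype.card_congr e
    rw [Fintype.card_fin] at h
    exact h.symm
  have hg : g' = g := by
    have h' := hd.card_eq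
    omega
  subst hg
  exact torusIntegral_wedgePow_neg_of_odd Φ hη hnd hd e hodd

/-- **(H1) in the polarised range, type-free**: `η` a Riemann form and `g` even ⇒ `∫_X η^{∧g} > 0`; use the full
name `Summit.Ventures.HSemireg.SecantParity.IsRiemannForm.torusIntegral_wedgePow_pos_of_even'` (dot-notation on a
tree `ComplexTorus.IsRiemannForm` does not resolve into this namespace — s4-ref g11 P-4).
[cite: Lange2023AbelianVarietiesComplex, §1.7.2 proof of Thm. 1.7.3] -/
theorem IsRiemannForm.torusIntegral_wedgePow_pos_of_even' (hη : IsRiemannForm Φ η) {g : ℕ}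
    (e : Fin (2 * g) ≃ ι) (hg : Even g) :
    0 < torusIntegral Φ e (wedgePow (ofRealForm η) g) := by
  rw [torusIntegral_wedgePow_pos_iff_even_hermIndex' Φ hη.isNSForm (hη.exists_apply_ne_zero Φ) e hg,
    hη.hermIndex_eq_zero Φ]
  exact Even.zero

end SecantParity

end Summit.Ventures.HSemireg
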